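import Mathlib
import Literature.Computability.AlgebraicComplexity.MS21SigmaPiOrbitsProofs
import Literature.Computability.AlgebraicComplexity.HittingSetsCoefficientCover
import HarnessLib

/-!
# Medini–Shpilka 2021, §1.1.6: the coefficients of `f(Ax + b)` are polynomials of degree `≤ deg f`
# in the entries of `(A, b)` — the universal coefficient map of an affine orbit, and hitting sets
# for affine orbits by coefficient cover

Medini–Shpilka (CCC 2021, LIPIcs 200:19 = arXiv:2102.05632), §1.1.6 eq. (2), define `f(Ax + b)` for
`f ∈ F[x_1..x_m]`, `A ∈ F^{n × n}`, `b ∈ Fⁿ` (`MS2021.affSubst`), and the orbit `f^{GLaff_n(F)}`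
(`MS2021.affOrbit`). This file records the bookkeeping behind every "there is a hitting set of size
poly(n)" corollary of that paper (Cor 29, Thm 30, Cor 34, Cor 36, Cor 44 — "existence and size only"
as typed in `MS21DenseOrbitsHittingSets.lean`): viewing the `n² + n` entries of `(A, b)` as
indeterminates `y`,

* `MS2021.AffineOrbitCoeff.coeffPoly h g μ` := the coefficient of `x^μ` in `g(Ax + b)` as a polynomial
  in `y` (the universal coefficient map; `map (eval y_{A,b})` recovers `g(Ax+b)`,
  `map_eval_params_aeval_genForms`, `eval_coeffPoly`);
* `totalDegree_coeffPoly_le`: its total degree is `≤ deg g` (graded induction on `g`);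
* `exists_coeff_parametrisation`: the packaging expected by the tree's coefficient-cover hitting-set
  engine `CoeffCover.exists_hittingSet` (Heintz–Schnorr style, AC/HittingSetsCoefficientCover.lean);
* `exists_hittingSet_affOrbit`: for every `g` of degree `≤ d` and every grid `S ⊆ F`, `|S| ≥ 2d`,
  `S ≠ ∅`, a set `H ⊆ Sⁿ` of at most `(n·n + n)(log₂(|S|ⁿ d + 1) + 1) + 1` points hits every nonzero
  member of the affine orbit `g^{GLaff_n(F)}` (invertibility of `A` is not used).

`VP ≠ VNP` is NOT proved and nothing here bears on it; this is parametrisation bookkeeping for the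
typed Medini–Shpilka existence statements.

## References
* [MediniShpilka2021] D. Medini, A. Shpilka, CCC 2021, LIPIcs 200:19, §1.1.6 eq. (2) (CCC p.19:9;
  arXiv p0007:L7-L18) and Cor 29 / Thm 30 / Cor 34 / Cor 36 / Cor 44 (existence of small hitting and
  interpolating sets for affine orbits).
* J. Heintz, C.-P. Schnorr, *Testing polynomials which are easy to compute*, STOC 1980, Thm 4.4
  (the coefficient-cover engine, tree file `HittingSetsCoefficientCover`).
-/

noncomputable section

open MvPolynomial

namespace Literature.Computability.AlgebraicComplexity

namespace MS2021

namespace AffineOrbitCoeff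

variable {K : Type*} [Field K]

/-! ### The generic affine forms over the parameter ring `K[y]`, `y = (A, b)` -/

/-- The parameter index of the matrix entry `A i j` (`i, j < n`) among the `n·n + n` parameters.
[cite: MediniShpilka2021, §1.1.6 eq. (2) (CCC p.19:9; arXiv p0007:L7-L18)] -/
def idxA (n : ℕ) (i j : Fin n) : Fin (n * n + n) := Fin.castAdd n (finProdFinEquiv (i, j))

/-- The parameter index of the vector entry `b i` (`i < n`). [cite: MediniShpilka2021, §1.1.6 eq. (2) (CCC p.19:9; arXiv p0007:L7-L18)] -/
def idxb (n : ℕ) (i : Fin n) : Fin (n * n + n) := Fin.natAdd (n * n) i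

/-- The parameter point of a concrete pair `(A, b)`. [cite: MediniShpilka2021, §1.1.6 eq. (2) (CCC p.19:9; arXiv p0007:L7-L18)] -/
def params (n : ℕ) (A : Matrix (Fin n) (Fin n) K) (b : Fin n → K) : Fin (n * n + n) → K :=
  Fin.append (fun l => A (finProdFinEquiv.symm l).1 (finProdFinEquiv.symm l).2) b

omit [Field K] in
/-- `params` reads `A i j` at `idxA i j`. [cite: MediniShpilka2021, §1.1.6 eq. (2) (CCC p.19:9)] -/
@[simp] theorem params_idxA (n : ℕ) (A : Matrix (Fin n) (Fin n) K) (b : Fin n → K) (i j : Fin n) :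
    params n A b (idxA n i j) = A i j := by
  rw [params, idxA, Fin.append_left, Equiv.symm_apply_apply]

omit [Field K] in
/-- `params` reads `b i` at `idxb i`. [cite: MediniShpilka2021, §1.1.6 eq. (2) (CCC p.19:9)] -/
@[simp] theorem params_idxb (n : ℕ) (A : Matrix (Fin n) (Fin n) K) (b : Fin n → K) (i : Fin n) :
    params n A b (idxb n i) = b i := by
  rw [params, idxb, Fin.append_right]

/-- The generic affine forms `∑_j y_{A i j} x_j + y_{b i}` (`i < m ≤ n`) with INDETERMINATE
coefficients, over the parameter ring `K[y]`. [cite: MediniShpilka2021, §1.1.6 eq. (2) (CCC p.19:9; arXiv p0007:L7-L10)] -/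
def genForms {m n : ℕ} (h : m ≤ n) (i : Fin m) :
    MvPolynomial (Fin n) (MvPolynomial (Fin (n * n + n)) K) :=
  (∑ j : Fin n, C (X (idxA n (Fin.castLE h i) j)) * X j) + C (X (idxb n (Fin.castLE h i)))

/-- The universal coefficient map of the affine orbit of `g`: the coefficient of `x^μ` in `g(Ax + b)`
as a polynomial in the entries of `(A, b)`. [cite: MediniShpilka2021, §1.1.6 eq. (2) (CCC p.19:9; arXiv p0007:L7-L18)] -/
def coeffPoly {m n : ℕ} (h : m ≤ n) (g : MvPolynomial (Fin m) K) (μ : Fin n →₀ ℕ) :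
    MvPolynomial (Fin (n * n + n)) K :=
  coeff μ (aeval (genForms h) g)

/-! ### Evaluation: specialising the parameters gives `g(Ax + b)` -/

/-- Specialising the parameters at `(A, b)` turns `g(generic forms)` into `g(Ax + b)`.
[cite: MediniShpilka2021, §1.1.6 eq. (2) (CCC p.19:9; arXiv p0007:L7-L18)] -/
theorem map_eval_params_aeval_genForms {m n : ℕ} (h : m ≤ n) (g : MvPolynomial (Fin m) K)
    (A : Matrix (Fin n) (Fin n) K) (b : Fin n → K) :
    MvPolynomial.map (MvPolynomial.eval (params n A b)) (aeval (genForms h) g) =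
      affSubst h A b g := by
  have key : (mapAlgHom (aeval (params n A b)) :
      MvPolynomial (Fin n) (MvPolynomial (Fin (n * n + n)) K) →ₐ[K] MvPolynomial (Fin n) K)
        (aeval (genForms h) g) = affSubst h A b g := by
    unfold affSubst
    rw [comp_aeval_apply]
    have hfun : (fun i : Fin m => (mapAlgHom (aeval (params n A b)) :
        MvPolynomial (Fin n) (MvPolynomial (Fin (n * n + n)) K) →ₐ[K] MvPolynomial (Fin n) K)
          (genForms h i)) =
        fun i : Fin m => (∑ j : Fin n, C (A (Fin.castLE h i) j) * X j) + C (b (Fin.castLE h i)) := by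
      funext i
      rw [mapAlgHom_apply, genForms]
      simp only [map_add, map_sum, map_mul, map_C, map_X, coe_aeval_eq_eval, eval_X, params_idxA,
        params_idxb]
    rw [hfun]
  rw [← key, mapAlgHom_apply]
  rfl

/-- Coefficientwise: `coeff_μ (g(Ax+b)) = (coeffPoly h g μ)(A, b)`. [cite: MediniShpilka2021, §1.1.6 eq. (2) (CCC p.19:9; arXiv p0007:L7-L18)] -/
theorem eval_coeffPoly {m n : ℕ} (h : m ≤ n) (g : MvPolynomial (Fin m) K)
    (A : Matrix (Fin n) (Fin n) K) (b : Fin n → K) (μ : Fin n →₀ ℕ) :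
    eval (params n A b) (coeffPoly h g μ) = coeff μ (affSubst h A b g) := by
  rw [← map_eval_params_aeval_genForms h g A b, coeff_map, coeffPoly]

/-! ### Degree: the coefficients have degree `≤ deg g` in the parameters -/

section Degree

variable {n p : ℕ}

/-- Graded bound on parameter-degrees of coefficients: closed under sums. [folklore] -/
private theorem coeffDeg_add {D : ℕ} {P Q : MvPolynomial (Fin n) (MvPolynomial (Fin p) K)}
    (hP : ∀ μ, (coeff μ P).totalDegree ≤ D) (hQ : ∀ μ, (coeff μ Q).totalDegree ≤ D) :
    ∀ μ, (coeff μ (P + Q)).totalDegree ≤ D := fun μ => by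
  rw [coeff_add]
  exact (totalDegree_add _ _).trans (max_le (hP μ) (hQ μ))

/-- Graded bound on parameter-degrees of coefficients: closed under finite sums. [folklore] -/
private theorem coeffDeg_sum {ι : Type*} (s : Finset ι) {D : ℕ}
    {P : ι → MvPolynomial (Fin n) (MvPolynomial (Fin p) K)}
    (hP : ∀ i ∈ s, ∀ μ, (coeff μ (P i)).totalDegree ≤ D) :
    ∀ μ, (coeff μ (∑ i ∈ s, P i)).totalDegree ≤ D := fun μ => by
  rw [coeff_sum]
  exact totalDegree_finsetSum_le fun i hi => hP i hi μ

/-- Graded bound on parameter-degrees of coefficients: products add degrees. [folklore] -/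
private theorem coeffDeg_mul {D E : ℕ} {P Q : MvPolynomial (Fin n) (MvPolynomial (Fin p) K)}
    (hP : ∀ μ, (coeff μ P).totalDegree ≤ D) (hQ : ∀ μ, (coeff μ Q).totalDegree ≤ E) :
    ∀ μ, (coeff μ (P * Q)).totalDegree ≤ D + E := fun μ => by
  classical
  rw [coeff_mul]
  exact totalDegree_finsetSum_le fun x _ =>
    (totalDegree_mul _ _).trans (add_le_add (hP x.1) (hQ x.2))

/-- Graded bound: products over a finset. [folklore] -/
private theorem coeffDeg_prod {ι : Type*} (s : Finset ι) {D : ι → ℕ}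
    {P : ι → MvPolynomial (Fin n) (MvPolynomial (Fin p) K)}
    (hP : ∀ i ∈ s, ∀ μ, (coeff μ (P i)).totalDegree ≤ D i) :
    ∀ μ, (coeff μ (∏ i ∈ s, P i)).totalDegree ≤ ∑ i ∈ s, D i := by
  classical
  induction s using Finset.induction_on with
  | empty =>
    intro μ
    rw [Finset.prod_empty, Finset.sum_empty, coeff_one]
    split_ifs <;> simp
  | insert a s ha ih =>
    intro μ
    rw [Finset.prod_insert ha, Finset.sum_insert ha]
    exact coeffDeg_mul (hP a (Finset.mem_insert_self a s))
      (ih fun i hi => hP i (Finset.mem_insert_of_mem hi)) μ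

/-- Graded bound: powers multiply degrees. [folklore] -/
private theorem coeffDeg_pow {D : ℕ} {P : MvPolynomial (Fin n) (MvPolynomial (Fin p) K)}
    (hP : ∀ μ, (coeff μ P).totalDegree ≤ D) (e : ℕ) :
    ∀ μ, (coeff μ (P ^ e)).totalDegree ≤ e * D := by
  induction e with
  | zero =>
    intro μ
    rw [pow_zero, coeff_one, zero_mul]
    split_ifs <;> simp
  | succ e ih =>
    intro μ
    rw [pow_succ, Nat.succ_mul]
    exact coeffDeg_mul ih hP μ

/-- Constants of the base field have parameter-degree `0`. [folklore] -/
private theorem coeffDeg_C_C (a : K) :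
    ∀ μ, (coeff μ (C (C a) : MvPolynomial (Fin n) (MvPolynomial (Fin p) K))).totalDegree ≤ 0 :=
  fun μ => by
  classical
  rw [coeff_C]
  split_ifs <;> simp

/-- A parameter times a variable has parameter-degree `≤ 1`. [folklore] -/
private theorem coeffDeg_C_X_mul_X (l : Fin p) (j : Fin n) :
    ∀ μ, (coeff μ (C (X l) * X j : MvPolynomial (Fin n) (MvPolynomial (Fin p) K))).totalDegree ≤ 1 :=
  fun μ => by
  classical
  rw [coeff_C_mul, coeff_X]
  split_ifs <;> simp [totalDegree_X]

/-- A parameter as a constant has parameter-degree `≤ 1`. [folklore] -/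
private theorem coeffDeg_C_X (l : Fin p) :
    ∀ μ, (coeff μ (C (X l) : MvPolynomial (Fin n) (MvPolynomial (Fin p) K))).totalDegree ≤ 1 :=
  fun μ => by
  classical
  rw [coeff_C]
  split_ifs <;> simp [totalDegree_X]

end Degree

/-- The generic affine forms have parameter-degree `≤ 1` coefficientwise. [cite: MediniShpilka2021, §1.1.6 eq. (2) (CCC p.19:9)] -/
theorem totalDegree_coeff_genForms_le {m n : ℕ} (h : m ≤ n) (i : Fin m) (μ : Fin n →₀ ℕ) :
    (coeff μ (genForms (K := K) h i)).totalDegree ≤ 1 := by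
  unfold genForms
  have h1 := coeffDeg_sum (K := K) (Finset.univ : Finset (Fin n)) (D := 1)
    (P := fun j => C (X (idxA n (Fin.castLE h i) j)) * X j)
    (fun j _ => coeffDeg_C_X_mul_X _ _)
  exact coeffDeg_add h1 (coeffDeg_C_X _) μ

/-- **The coefficients of `g(Ax+b)` have degree `≤ deg g` in `(A, b)`.**
[cite: MediniShpilka2021, §1.1.6 eq. (2) (CCC p.19:9; arXiv p0007:L7-L18)] -/
theorem totalDegree_coeffPoly_le {m n : ℕ} (h : m ≤ n) (g : MvPolynomial (Fin m) K)
    (μ : Fin n →₀ ℕ) : (coeffPoly h g μ).totalDegree ≤ g.totalDegree := by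
  classical
  unfold coeffPoly
  have hsum : aeval (genForms (K := K) h) g =
      ∑ α ∈ g.support, aeval (genForms (K := K) h) (monomial α (coeff α g)) := by
    conv_lhs => rw [g.as_sum]
    rw [map_sum]
  rw [hsum]
  refine coeffDeg_sum (K := K) g.support (fun α hα => ?_) μ
  intro ν
  rw [aeval_monomial, Finsupp.prod]
  have hC : (algebraMap K (MvPolynomial (Fin n) (MvPolynomial (Fin (n * n + n)) K))) (coeff α g) =
      C (C (coeff α g)) := rfl
  rw [hC]
  have hprod := coeffDeg_prod (K := K) α.support (D := fun i => α i * 1)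
    (P := fun i => genForms h i ^ α i)
    (fun i _ => coeffDeg_pow (totalDegree_coeff_genForms_le h i) (α i))
  have := coeffDeg_mul (coeffDeg_C_C (coeff α g)) hprod ν
  refine this.trans ?_
  rw [zero_add]
  simp_rw [mul_one]
  exact le_totalDegree hα

/-! ### Packaging for the coefficient-cover engine and the hitting set -/

/-- **Parametrisation of an affine orbit in the format of `CoeffCover.exists_hittingSet`.**
[cite: MediniShpilka2021, §1.1.6 eq. (2) and Cor 29 / Thm 30 / Cor 44 (CCC p.19:9, 19:12, 19:14)] -/
theorem exists_coeff_parametrisation {m n d : ℕ} (h : m ≤ n) (g : MvPolynomial (Fin m) K)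
    (hg : g.totalDegree ≤ d) :
    ∃ Gm : {μ : Fin n →₀ ℕ | μ.degree ≤ d} → MvPolynomial (Fin (n * n + n)) K,
      (∀ μ, (Gm μ).totalDegree ≤ d) ∧
      ∀ f ∈ affOrbit n g, ∃ y : Fin (n * n + n) → K, ∀ μ, eval y (Gm μ) = coeff (μ : Fin n →₀ ℕ) f :=
  ⟨fun μ => coeffPoly h g μ, fun μ => (totalDegree_coeffPoly_le h g μ).trans hg,
    fun f hf => by
      obtain ⟨h', A, b, -, rfl⟩ := hf
      exact ⟨params n A b, fun μ => eval_coeffPoly h g A b μ⟩⟩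

/-- **Hitting sets for affine orbits by coefficient cover.** For `g ∈ F[x_1..x_m]` of degree `≤ d`,
`m ≤ n`, and a nonempty grid `S ⊆ F` with `|S| ≥ 2d`, some `H ⊆ Sⁿ` with
`|H| ≤ (n·n + n)(log₂(|S|ⁿ·d + 1) + 1) + 1` hits every nonzero `f ∈ g^{GLaff_n(F)}` — the
existence-and-size content of Medini–Shpilka's hitting-set corollaries for a single orbit, without any
independence-map generator. [cite: MediniShpilka2021, Cor 29 / Cor 44 (CCC p.19:12, 19:14; existence of poly-size hitting sets for affine orbits)] -/
theorem exists_hittingSet_affOrbit {m n d : ℕ} (h : m ≤ n) (g : MvPolynomial (Fin m) K)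
    (hg : g.totalDegree ≤ d) (S : Finset K) (hS1 : S.Nonempty) (hS : 2 * d ≤ S.card) :
    ∃ H : Finset (Fin n → K), (∀ a ∈ H, ∀ i, a i ∈ S) ∧
      H.card ≤ (n * n + n) * (Nat.log 2 (S.card ^ n * d + 1) + 1) + 1 ∧
      ∀ f ∈ affOrbit n g, f ≠ 0 → ∃ a ∈ H, eval a f ≠ 0 := by
  obtain ⟨Gm, hGm, hcov⟩ := exists_coeff_parametrisation h g hg
  obtain ⟨H, hHS, hHcard, hhit⟩ := CoeffCover.exists_hittingSet (F := K) n d (n * n + n) d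
    (Finsupp.finite_of_degree_le (σ := Fin n) d) Gm hGm S hS1 hS
  refine ⟨H, hHS, hHcard, fun f hf hf0 => ?_⟩
  have hfd : f.totalDegree ≤ d := by
    obtain ⟨h', A, b, -, rfl⟩ := hf
    exact (totalDegree_affSubst_le h' A b g).trans hg
  exact hhit f hfd (hcov f hf) hf0

end AffineOrbitCoeff

end MS2021

end Literature.Computability.AlgebraicComplexity

end
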